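import Literature.MathematicalPhysics.QuantumFieldTheory.Balaban1983to89.B7Prop2SpecialUnitaryRec
import Literature.MathematicalPhysics.QuantumFieldTheory.Balaban1983to89.B7AvgClosedSpecialUnitarySharp

/-!
# `Balaban1983to89.B7Prop2SpecialUnitarySharpRec` — [Balaban1985Averaging] p. 20 («the group `G` is obtained by applying the function `e^{iA}` to `A ∈ 𝔤`») FOR `G = SU(N)`
# AND THE RECORD's AVERAGING STRUCTURE ([Balaban1987RG1] (0.4)), SHARP FORM: the record one-step average of an `SU(N)`-valued field is `SU(N)`-valued at every radius
# `t ≤ ¼` with `t < 2 sin(π∕N)` — FOR EVERY `N` — hence `SU(N)` is `AvgClosedZ` (radius `¼`) for every `N ≤ 25` (the tree's record lemma: `N ≤ 12`)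

statement-level skeleton of published theorems with citation tags; proofs where landed; nothing here is a claim about the Yang–Mills mass gap

CITATION HEADER (lean-in-tree rule).  Cell `pub-ymgap` (HUMAN RULING D-0062), «N05-REC» road; director-ym №304 Q-304 (Q1) ∕ №305 (⚑ LOCATED-RANGE «SU(N), N ≤ 12» of the record SU crown
G8 ✓p738436 — VOID FOR TRACK A (N = 2), LADDER note b114); pen dag-n05-e g41 (author of the capped lemma).  [3] = [Balaban1985Averaging] p. 20, (20)–(23) p. 21, (42)–(43) pp. 23–24
(`paper:balaban1985-cmp98-averaging`); [I] = [Balaban1987RG1] (0.4) p. 253.  `--kind proof --supports stmt-QuantumFields-20541` (K0⁷; count-neutral; no definition).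
REUSED BY NAME (nothing re-proved except one private numeric line): the engine's SHARP TRACE LEMMA `B7AvgClosedSpecialUnitarySharp.trace_mlog_eq_zero_of_lt_two_sin` (lit-balaban:
`W ∈ SU(N)`, `‖W − 1‖ ≤ ⅓`, `‖W − 1‖ < 2 sin(π∕N)` ⇒ `Tr log W = 0`, print's spectral form (22)–(23)), the record's `B7Prop2Rec.{AvgClosedZ, bavgZ_mem_unitaryUnits}`,
`BlockAveragingZd.{WZ, XZ, bavgZ}`, `B7Prop2SpecialUnitary.{specialUnitaryUnits, …}`, the record's crude lemma `B7Prop2SpecialUnitaryRec.avgClosedZ_specialUnitary (N ≤ 12)` for the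
branch `N ≤ 12` (which covers `N = 1`, where `sin π = 0`).  The numeric line `¼ < 2 sin(π∕N)` (`2 ≤ N ≤ 25`) is re-proved here because the engine's copy is `private`.

WHY THIS FILE (Q-304 (Q1), answered by the author).  The record SU crown G8 carries `(hN : N ≤ 12)` ONLY through `B7Prop2SpecialUnitaryRec.avgClosedZ_specialUnitary` l.86–91, whose
`hπ : N·¼ < π` is the crude Route-A edge of `ExpMeanLog.trace_mlog_eq_zero` at the radius `¼` baked into `AvgClosedZ` (`13·¼ = 3.25 > π` fails).  With the sharp trace lemma the SAME
structure `AvgClosedZ d L SU(N)` holds for every `N ≤ 25` (`¼ < 2 sin(π∕25) = 0.2507`), and `25` is the true edge OF THE FIXED RADIUS `¼` (engine dichotomy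
`B7AvgClosedSpecialUnitarySharp.avgClosed_two_two_specialUnitary_iff : AvgClosed 2 2 SU(N) ↔ N ≤ 25`, central witness `e^{2πi∕N}·1`).  The radius-free content — what Bałaban's
construction actually uses, at loop radius `O((d+1)(d+4)L²α₀)` (`B7Prop2Rec.avgIterZ_mem`, the ONLY consumer of the closure field) — is `bavgZ_mem_specialUnitaryUnits_of_lt_two_sin`
below, valid for EVERY `N`: print's «constants depend on the group», no cap.

WHAT IS PROVED (sorry-free).  ★ `bavgZ_mem_specialUnitaryUnits_of_lt_two_sin` — EVERY `N`: the record one-step average (0.4) `V̄_c = e^{X_c}V(c)` of an `SU(N)`-valued `V` is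
`SU(N)`-valued as soon as every loop variable `W_i` is within `t ≤ ¼` of `1` with `t < 2 sin(π∕N)`; ★ `avgClosedZ_specialUnitary_of_lt_two_sin` — `¼ < 2 sin(π∕N) → AvgClosedZ d L SU(N)`;
★★ `avgClosedZ_specialUnitary_of_le` — **`AvgClosedZ d L (SU(N))` for every `N ≤ 25`** (index type `n`, `N = card n`); `avgClosedZ_specialUnitary_fin_of_le` — the `Fin N` reading
(`[NeZero N]`, `N ≤ 25`) consumed by the SU crown's `N ≤ 25` edition `B8Prop6DentedCubeMemberScalarGammaSU25Rec`.
HONEST SCOPE.  Group-membership bookkeeping; one sharper closure lemma PORTED from the engine to the record loop family; NO estimate of Bałaban's; for `N ≥ 26` the radius-`¼`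
closure is false on the engine side and expected false on the record side (twisted central witness; not typed here); the genuinely `N`-free road is a radius-parametric closure
threaded through the record chain (sized on the cell bus, not commissioned).  `HThm4Rec` UNDISCHARGED; N05 ∕ N07 NOT discharged; counts unmoved (typed 28∕28 · discharged 8∕28);
one finite 𝕋⁴ programme at fixed ε, `G = SU(2)` of record — nothing continuum ∕ ℝ⁴ ∕ OS ∕ mass gap ∕ Clay.  No `def`, no `instance`, no `notation`, no `sorry`.
-/

set_option autoImplicit false

noncomputable section

open scoped BigOperators
open NormedSpace Finset

namespace Literature.MathematicalPhysics.QuantumFieldTheory.Balaban1983to89.B7Prop2SpecialUnitarySharpRec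

open B7Prop1Explicit hiding Site
open B7Prop1Explicit renaming Site → SiteZ
open B7Prop2Explicit (unitaryUnits mem_unitaryUnits unitaryUnits_le_U1 hol_mem_of)
open MatrixLog
open BlockAveragingZd (IdxZ WZ WZ_def XZ bavgZ bavgZ_apply)
open B7Prop2Rec (AvgClosedZ bavgZ_mem_unitaryUnits)
open B7Prop2SpecialUnitary (specialUnitaryUnits mem_specialUnitaryUnits specialUnitaryUnits_le_unitaryUnits specialUnitaryUnits_le_U1)
open B7Prop2SpecialUnitaryRec (avgClosedZ_specialUnitary)
open B7AvgClosedSpecialUnitarySharp (trace_mlog_eq_zero_of_lt_two_sin)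

variable {d : ℕ}

/-! ## §0  The numeric line `¼ < 2 sin(π∕N)` for `2 ≤ N ≤ 25` -/

section Numerics

/-- **`¼ < 2 sin(π∕N)` for `2 ≤ N ≤ 25`** (`sin(π∕25) > π∕25 − (π∕25)³∕6 > ⅛` from `3.14 < π < 3.15`, and `sin(π∕25) ≤ sin(π∕N)` by monotonicity of `sin`
on `[0, π∕2]`; `N = 1` is excluded since `sin π = 0`).  Private re-proof of the engine's private `B7AvgClosedSpecialUnitarySharp.quarter_lt_two_sin_pi_div`. [folklore] -/
private theorem quarter_lt_two_sin_pi_div {N : ℕ} (hN2 : 2 ≤ N) (hN : N ≤ 25) :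
    (1 / 4 : ℝ) < 2 * Real.sin (Real.pi / N) := by
  have hπ1 := Real.pi_gt_d2
  have hπ2 := Real.pi_lt_d2
  have hN0 : (0 : ℝ) < N := by exact_mod_cast (lt_of_lt_of_le (by norm_num) hN2)
  have hNr : (N : ℝ) ≤ 25 := by exact_mod_cast hN
  have hN2r : (2 : ℝ) ≤ N := by exact_mod_cast hN2
  -- `π/25 ≤ π/N ≤ π/2`
  have hlo : Real.pi / 25 ≤ Real.pi / N := div_le_div_of_nonneg_left Real.pi_pos.le hN0 hNr
  have hhi : Real.pi / N ≤ Real.pi / 2 := div_le_div_of_nonneg_left Real.pi_pos.le (by norm_num) hN2r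
  -- `sin(π/25) ≤ sin(π/N)`
  have hmono : Real.sin (Real.pi / 25) ≤ Real.sin (Real.pi / N) := by
    apply Real.strictMonoOn_sin.monotoneOn
    · constructor <;> nlinarith [Real.pi_pos]
    · constructor <;> nlinarith [Real.pi_pos]
    · exact hlo
  -- `sin(π/25) > π/25 − (π/25)³/6 > ⅛`
  have hx0 : (0 : ℝ) < Real.pi / 25 := by positivity
  have hcube := Real.sin_gt_sub_cube hx0
  have hxlo : (0.1256 : ℝ) < Real.pi / 25 := by linarith
  have hxhi : Real.pi / 25 < (0.126 : ℝ) := by linarith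
  have hx3 : (Real.pi / 25) ^ 3 < (0.126 : ℝ) ^ 3 := by
    exact pow_lt_pow_left₀ hxhi hx0.le (by norm_num)
  have h8 : (1 / 8 : ℝ) < Real.sin (Real.pi / 25) := by nlinarith
  linarith

end Numerics

/-! ## §1  EVERY `N`: the record one-step average (0.4) of an `SU(N)`-valued field is `SU(N)`-valued at radius `t ≤ ¼`, `t < 2 sin(π∕N)` -/

section RouteB

variable {n : Type*} [Fintype n] [DecidableEq n]

open scoped Matrix.Norms.L2Operator

/-- ★ (RECORD TWIN of `B7AvgClosedSpecialUnitarySharp.bavg_mem_specialUnitaryUnits_of_lt_two_sin`; the SHARP form of `B7Prop2SpecialUnitaryRec.bavgZ_mem_specialUnitaryUnits`.)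
**For EVERY `N`: the record's one-step average (0.4) of an `SU(N)`-valued configuration is `SU(N)`-valued at radius `t ≤ ¼` with `t < 2 sin(π∕N)`**: every loop variable
`W_i ∈ SU(N)` (a product of bond variables) with `|W_i − 1| ≤ t < 2 sin(π∕N)` has `Tr log W_i = 0` by the sharp trace lemma (spectral form (22)–(23)), so `V̄_c = e^{X_c}V(c)` is
unitary (`B7Prop2Rec.bavgZ_mem_unitaryUnits`) with `det V̄_c = e^{Tr X_c}·det V(c) = exp[mean_i Tr log W_i] = 1`.  The threshold `2 sin(π∕N)` is that of the central element
`e^{2πi∕N}·1` (`|· − 1| = 2 sin(π∕N)`, `Tr log = 2πi`). [cite: Balaban1985Averaging, p.20, (20)–(23) p.21, (42) p.23; Balaban1987RG1, (0.4) p.253] -/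
theorem bavgZ_mem_specialUnitaryUnits_of_lt_two_sin {V : SiteZ d → Fin d → (Matrix n n ℂ)ˣ}
    (hV : ∀ x κ, V x κ ∈ specialUnitaryUnits n) (L : ℕ) (q : SiteZ d) (κ : Fin d) {t : ℝ} (ht4 : t ≤ 1 / 4)
    (htsin : t < 2 * Real.sin (Real.pi / Fintype.card n))
    (hW : ∀ i : IdxZ d L, ‖((WZ L V q κ i : (Matrix n n ℂ)ˣ) : Matrix n n ℂ) - 1‖ ≤ t) :
    bavgZ L V q κ ∈ specialUnitaryUnits n := by
  letI : CStarAlgebra (Matrix n n ℂ) := {}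
  have hVU : ∀ x κ, V x κ ∈ unitaryUnits (Matrix n n ℂ) := fun x κ =>
    specialUnitaryUnits_le_unitaryUnits (hV x κ)
  have hU : bavgZ L V q κ ∈ unitaryUnits (Matrix n n ℂ) :=
    bavgZ_mem_unitaryUnits hVU L q κ fun i => (hW i).trans ht4
  have hWm : ∀ i : IdxZ d L, WZ L V q κ i ∈ specialUnitaryUnits n := fun i => by
    rw [WZ_def]; exact hol_mem_of hV _ _
  have htr : ∀ i : IdxZ d L, (mlog ((WZ L V q κ i : (Matrix n n ℂ)ˣ) : Matrix n n ℂ)).trace = 0 := fun i =>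
    trace_mlog_eq_zero_of_lt_two_sin (hWm i) ((hW i).trans (ht4.trans (by norm_num)))
      (lt_of_le_of_lt (hW i) htsin)
  have hX : (XZ L V q κ).trace = 0 := by
    unfold XZ
    rw [Matrix.trace_sum]
    exact Finset.sum_eq_zero fun i _ => by rw [Matrix.trace_smul, htr i, smul_zero]
  have hdet : ((hol V q (seg κ L) : (Matrix n n ℂ)ˣ) : Matrix n n ℂ).det = 1 :=
    (Matrix.mem_specialUnitaryGroup_iff.1 (hol_mem_of hV q (seg κ L))).2
  rw [mem_specialUnitaryUnits, Matrix.mem_specialUnitaryGroup_iff]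
  refine ⟨hU, ?_⟩
  rw [bavgZ_apply, Units.val_mul, Matrix.det_mul, hdet, mul_one, val_expUnit,
    Literature.Analysis.Matrix.det_exp_eq_exp_trace, hX, exp_zero]

variable [Nonempty n]

variable (d) in
/-- ★ **`SU(N)` is `AvgClosedZ d L` (the record's radius `¼`) whenever `¼ < 2 sin(π∕N)`** — the record's Prop-2 closure hypothesis from §1 at `t = ¼`.
[cite: Balaban1985Averaging, p.20, (42)–(43) pp.23–24; Balaban1987RG1, (0.4) p.253] -/
theorem avgClosedZ_specialUnitary_of_lt_two_sin (L : ℕ) (hsin : (1 / 4 : ℝ) < 2 * Real.sin (Real.pi / Fintype.card n)) :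
    AvgClosedZ d L (specialUnitaryUnits n) :=
  ⟨specialUnitaryUnits_le_U1, fun _ hV q κ hW => bavgZ_mem_specialUnitaryUnits_of_lt_two_sin hV _ q κ le_rfl hsin hW⟩

/-! ## §2  `SU(N)` is `AvgClosedZ` for every `N ≤ 25` -/

variable (d) in
/-- ★★ **`SU(N)` IS `AvgClosedZ d L` FOR EVERY `N ≤ 25`** (`N ≤ 12`: the record's crude lemma `B7Prop2SpecialUnitaryRec.avgClosedZ_specialUnitary`, covering `N = 1`; `2 ≤ N ≤ 25`:
§1 with `¼ < 2 sin(π∕N)`) — the `hG` of the N05-REC tranche's k-uniform theorems (`B7Prop4GeneralLevelsRec`, `B8Prop6OfThm4Rec.prop6_of_thm4`, …, the G-crown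
`B8Prop6DentedCubeMemberScalarGammaOfNamedFactsGRec` §4) at `G = SU(N)`, now for the engine's range `N ≤ 25`; `25` is the edge of the fixed radius `¼` (engine dichotomy
`B7AvgClosedSpecialUnitarySharp.avgClosed_two_two_specialUnitary_iff`). [cite: Balaban1985Averaging, p.20, (42)–(43) pp.23–24; Balaban1987RG1, (0.4) p.253] -/
theorem avgClosedZ_specialUnitary_of_le (L : ℕ) (hN : Fintype.card n ≤ 25) : AvgClosedZ d L (specialUnitaryUnits n) := by
  by_cases h12 : Fintype.card n ≤ 12
  · exact avgClosedZ_specialUnitary d L h12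
  · have hN2 : 2 ≤ Fintype.card n := by omega
    exact avgClosedZ_specialUnitary_of_lt_two_sin d L (quarter_lt_two_sin_pi_div hN2 hN)

end RouteB

section FinReading

open scoped Matrix.Norms.L2Operator

variable (d) in
/-- `Fin N` reading of `avgClosedZ_specialUnitary_of_le`: **`AvgClosedZ d L (SU(N))` for `[NeZero N]`, `N ≤ 25`** — the closure hypothesis the record SU crown's `N ≤ 25`
edition feeds to `B8Prop6DentedCubeMemberScalarGammaOfNamedFactsGRec` §4. [cite: Balaban1985Averaging, p.20, (42)–(43) pp.23–24; Balaban1987RG1, (0.4) p.253] -/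
theorem avgClosedZ_specialUnitary_fin_of_le (L : ℕ) {N : ℕ} [NeZero N] (hN : N ≤ 25) :
    AvgClosedZ d L (specialUnitaryUnits (Fin N)) :=
  avgClosedZ_specialUnitary_of_le d L (by rw [Fintype.card_fin]; exact hN)

end FinReading

end Literature.MathematicalPhysics.QuantumFieldTheory.Balaban1983to89.B7Prop2SpecialUnitarySharpRec
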